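import Mathlib
import Summits.CriticalPhenomena.CardyFormulaZ2.Theses.CardyMagicRigidity
import Literature.Probability.RandomPlanarGeometry.NestingTransform
import Literature.Probability.Percolation.FKLoopNestingGaussianLimit

/-!
# Sketch — crux NestingRigidity (stmt-CriticalPhenomena-4835), crux-ideate round 1, ideator 3

First lemmas of the two idea cards `pressure-branch-point` (A) and `ring-cloud-tomography` (B),
stated over existing declarations. Nothing is proved here; the point is that the statements
elaborate. `MZ2` below is the route's own decl
`Summit.CriticalPhenomena.CardyFormulaZ2.Theses.CardyMagicRigidity.MagicFormulaZ2`
(the first hypothesis of the crux `NestingRigidity ≡ MagicFormulaZ2 → MagicFormulaT → X`).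
-/

noncomputable section

open MeasureTheory Set Filter
open scoped Real Topology

namespace Summit.CriticalPhenomena.CardyFormulaZ2.Cruxes.NestingRigidity.Sketch

open Literature.Probability.RandomPlanarGeometry Literature.Probability.Percolation
  Literature.Probability.LatticeModels

/-- The route's first hypothesis (DKLM Cor. 10 at `q = 1`, density form). -/
abbrev MZ2 : Prop := _root_.Summit.CriticalPhenomena.CardyFormulaZ2.Theses.CardyMagicRigidity.MagicFormulaZ2

/-- Critical bond percolation on `ℤ²`. -/
abbrev Pz2 : Measure (BondConfig (Site 2)) := bondPercolation (zdGraph 2) half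

/-- Radial bump density of mass `1` on `B(x,r)`: `(π r²)⁻¹ 𝟙_{B(x,r)}`. -/
def bump (x : ℂ) (r : ℝ) : ℂ → ℝ := (Metric.ball x r).indicator fun _ ↦ (π * r ^ 2)⁻¹

/-- Ring density of mass `1`, uniform on the annulus `L ≤ ‖z‖ < 2L` (a "spectator ring"). -/
def ring (L : ℝ) : ℂ → ℝ := {z : ℂ | L ≤ ‖z‖ ∧ ‖z‖ < 2 * L}.indicator fun _ ↦ (3 * π * L ^ 2)⁻¹

/-- The lattice `cos_μ`-twisted nesting transform of bond-`ℤ²` at mesh `δ`: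
`Λ_δ(f) = E_{1/2}[∏_u 2cos(∫_{int u} f + π/3)]` (`LoopConfig.nestingWeight`, literally the
functional typed in `MagicFormulaZ2`, cf. `nestingWeight_eq_finprod`). -/
def Lam (f : ℂ → ℝ) (δ : ℝ) : ℝ := ∫ ω, (bondLoopConfig δ 0 ω).nestingWeight f ∂Pz2

/-- The loop weight `w(θ) = 2cos(θ + π/3)` seen by a loop carrying `f`-mass `θ`. -/
def w (θ : ℝ) : ℝ := 2 * Real.cos (θ + π / 3)

/-- Tower count of a typed loop configuration: number of loops (both types) whose interior
(non-zero winding number) contains `closedBall x r` and whose trace has diameter `≤ R`. -/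
def towerCount (c : LoopConfig ℂ) (x : ℂ) (r R : ℝ) : ℕ :=
  Set.ncard {u ∈ c.loops | Metric.closedBall x r ⊆ {z | u.wind z ≠ 0} ∧ Metric.diam u.range ≤ R}

/-- Positively weighted tower moment of bond-`ℤ²` at mesh `δ`: `E_δ[u^{N_x(r,R)}]`. -/
def towerMoment (u δ : ℝ) (x : ℂ) (r R : ℝ) : ℝ :=
  ∫ ω, u ^ towerCount (bondLoopConfig δ 0 ω) x r R ∂Pz2

/-- `m⁺_u(r) := limsup_{δ → 0⁺} E_δ[u^{N_0(r,1)}]` and `m⁻_u(r) := liminf` (no scaling limit of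
these moments is assumed to exist). -/
def towerUpper (u r : ℝ) : ℝ := limsup (fun δ ↦ towerMoment u δ 0 r 1) (𝓝[>] 0)

/-- See `towerUpper`. -/
def towerLower (u r : ℝ) : ℝ := liminf (fun δ ↦ towerMoment u δ 0 r 1) (𝓝[>] 0)

/-- SSW's CLE₆ one-point nesting exponent in the weight variable:
`e₆(u) = (3/4)((arccos(u/2)/π)² − 1/9)`, i.e. `e₆(2cos(λ+π/3)) = 3λ²/4π² + λ/2π`
(Schramm–Sheffield–Wilson 2009, Thm 1 / Kenyon–Wilson mgf, rewritten: `E[e^{sB}] = 1/u`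
with `B` the log-conformal-radius decrement). Even in `arccos(u/2)`, hence analytic at `u = 2`. -/
def e6 (u : ℝ) : ℝ := 3 / 4 * ((Real.arccos (u / 2) / π) ^ 2 - 1 / 9)

/-! ### Card A — `pressure-branch-point` -/

/-- **First lemma of line A (positive-regime two-point sum rule, honest sandwich form).** Under
the magic formula on `ℤ²`, for every charge `t ∈ (−π/6, π/6)` (both tower weights `w(±t)` and
all UV loop factors are then POSITIVE), the two-point functional
`Λ_δ(t(ρ_{0,r} − ρ_{1,r})) → exp(2βt²(log r + c_ρ))` (exact Gaussian, `β = 3/4π²`) sandwiches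
the product of the one-point tower moments by quasi-multiplicativity, whence the exponent sum
rule `e(w(t)) + e(w(−t)) = 3t²/2π²` in the form: limsup over `r` of the `m⁺`-exponent sum
`≤ 3t²/2π² ≤` liminf over `r` of the `m⁻`-exponent sum (equality as soon as the moments have a
scaling limit). Content: quasi-multiplicativity of positively weighted nesting functionals and
separation of the positive UV factors (RSW technology on `ℤ²`). -/
def PositiveRegimeSumRule : Prop :=
  MZ2 → ∀ t ∈ Set.Ioo (-(π / 6)) (π / 6),
    limsup (fun r : ℝ ↦ (Real.log (towerUpper (w t) r) + Real.log (towerUpper (w (-t)) r))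
      / Real.log r) (𝓝[>] 0) ≤ 3 * t ^ 2 / (2 * π ^ 2) ∧
    3 * t ^ 2 / (2 * π ^ 2) ≤ liminf (fun r : ℝ ↦ (Real.log (towerLower (w t) r)
      + Real.log (towerLower (w (-t)) r)) / Real.log r) (𝓝[>] 0)

/-- **Single-radius form** (same content, one bump shrinking, the other fixed): the Gaussian
attaches the exponent `βt²` EXACTLY to the radius of each bump; on the loop side that exponent is
`e(w(t)) − a·t` with `a = √3 ×` (nesting density per log-scale) the UV renormalisation drift,
whence `e(w(t)) = βt² + a t` on `|t| < π/6` with ONE unknown constant `a` (`a = 1/2π` for CLE₆). -/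
def SingleRadiusScaling : Prop :=
  MZ2 → ∀ (t r₂ : ℝ), t ∈ Set.Ioo (-(π / 6)) (π / 6) → 0 < r₂ → r₂ < 1 / 2 →
    Tendsto (fun r₁ : ℝ ↦ Real.log (limsup (fun δ ↦ Lam (fun z ↦ t * (bump 0 r₁ z - bump 1 r₂ z)) δ)
      (𝓝[>] 0)) / Real.log r₁) (𝓝[>] 0) (𝓝 (3 * t ^ 2 / (4 * π ^ 2)))

/-- **One-point tower rigidity for a law** `(μ, X)` on typed loop configurations (the `n = 1`
layer of the transfer C⁺ = nesting-tree rigidity): its positively weighted one-point tower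
exponents exist and are CLE₆'s `e₆(u)` for all `u ∈ (0, 2]` — in particular `e(0⁺) = 5/48`
(one arm) and nesting density `1/(2√3π)`. Line A proves it for every (quenched-)scale-stationary
subsequential `d_CN`-limit of bond-`ℤ²` from `PositiveRegimeSumRule` + real-analyticity of the
tower pressure `u ↦ e(u)` at the interior point `u = 2`, which is the branch point of
`arccos(u/2)`: the background charge is quantised, `a = 1/2π`. -/
def OnePointTowerRigidity {Ω : Type*} [MeasurableSpace Ω] (μ : Measure Ω) (X : Ω → LoopConfig ℂ) :
    Prop :=
  ∀ u ∈ Set.Ioc (0 : ℝ) 2, Tendsto (fun r : ℝ ↦ Real.log (∫ ω, u ^ towerCount (X ω) 0 r 1 ∂μ)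
    / Real.log r) (𝓝[>] 0) (𝓝 (e6 u))

/-- Lattice shadow of the `n = 1` target: if the one-point tower moments of bond-`ℤ²` have a
scaling limit at all, the magic formula forces their exponents to be CLE₆'s. -/
def OnePointTowerRigidityZ2 : Prop :=
  MZ2 → (∀ u ∈ Set.Ioc (0 : ℝ) 2, ∀ r ∈ Set.Ioo (0 : ℝ) 1, towerUpper u r = towerLower u r) →
    ∀ u ∈ Set.Ioc (0 : ℝ) 2,
      Tendsto (fun r : ℝ ↦ Real.log (towerUpper u r) / Real.log r) (𝓝[>] 0) (𝓝 (e6 u))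

/-! ### Card B — `ring-cloud-tomography` -/

/-- **First lemma of line B (exact ring factorisation).** A neutral pair of bumps sitting inside a
neutral pair of spectator rings: the twisted transform FACTORISES in the limit,
`Λ_δ(pair + rings) − Λ_δ(pair)·Λ_δ(rings) → 0`, although the loops cutting the rings and the
loops separating the pair are correlated and some loops carry mixed weights. Provable from `MZ2`
and potential theory alone: the logarithmic potential of a ring is constant inside it, so the
Gaussian cross energy of a neutral inner configuration with any ring vanishes and
`G(pair + rings) = G(pair)G(rings)` exactly. -/
def RingFactorisation : Prop :=
  MZ2 → ∀ (x y : ℂ) (r L t s : ℝ), 0 < r → 2 * r < ‖x - y‖ → ‖x‖ + r < L → ‖y‖ + r < L →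
    Tendsto (fun δ : ℝ ↦
      Lam (fun z ↦ t * (bump x r z - bump y r z) + s * (ring L z - ring (4 * L) z)) δ
        - Lam (fun z ↦ t * (bump x r z - bump y r z)) δ
          * Lam (fun z ↦ s * (ring L z - ring (4 * L) z)) δ) (𝓝[>] 0) (𝓝 0)

/-- **Charged-pair position independence (the tomography entry point).** A NON-neutral pair
(charges `a` at `x`, `b` at `y`) neutralised by ONE spectator ring: the limit transform depends
on the pair only through `‖x − y‖`, not on where the pair sits inside the ring (again exact
potential theory on the Gaussian side). On the loop side the tower above the pair now carries the
weight `w(a+b) ≠ 1` and the two towers the INDEPENDENT weights `w(a)`, `w(b)` — the pair's nesting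
data is probed off the "ellipse arc" of the crux's why-might-fail. -/
def ChargedPairPositionIndependence : Prop :=
  MZ2 → ∀ (x y x' y' : ℂ) (r L a b : ℝ), 0 < r → 2 * r < ‖x - y‖ → ‖x - y‖ = ‖x' - y'‖ →
    ‖x‖ + r < L → ‖y‖ + r < L → ‖x'‖ + r < L → ‖y'‖ + r < L →
    Tendsto (fun δ : ℝ ↦
      Lam (fun z ↦ a * bump x r z + b * bump y r z - (a + b) * ring L z) δ
        - Lam (fun z ↦ a * bump x' r z + b * bump y' r z - (a + b) * ring L z) δ) (𝓝[>] 0) (𝓝 0)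

end Summit.CriticalPhenomena.CardyFormulaZ2.Cruxes.NestingRigidity.Sketch

end
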